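import Mathlib
import Summits.ValiantsHypothesis.ValiantsHypothesis.Theorems.BarrierLeverPartitionMinorsHitByVPHiddenStatesFullJoinTrace

/-!
# Route BarrierLever — item `PartitionMinorsHitByVP` (stmt-ValiantsHypothesis-19717), line `hidden_states`:
# THE COMMON-CORE DOOR — any strict threshold design «core + free states» whose core BOTH families realise as traces hits the layout

Helper file (`--supports stmt-ValiantsHypothesis-19717`; cell valiant-natproofs, rung V4, 𝒟-side door (c), line
`Cruxes/PartitionMinorsHitByVP/Lines/hidden_states.lean` v9; prover seat val-np-p3 gen 17). Definition-free; closes NO item.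
The abstract two-sided form of the trace criterion (`exists_table_of_core_trace`, p684990): the cube-core door (`…FullJoinCubeCoreDoor`,
p686062) is its instance with core `2^[m]`; here the design is ANY injective strict threshold family `J : Fin r → Finset (Fin K)`
(`K ≤ h³`) split into CORE members (inside a state set closed under subsets among the members) and FREE singletons.

* `partitionMinor_hit_of_core_traces` — if the row family `u` realises every core member as a trace on `ι(core)` and the column family
  `w` does so on `ι'(core)` (two unrelated injections `ι, ι'` of the core states into `Fin h`), the partition minor `[u, w]` is hit
  inside `SmallCircuits ℂ (h + h) 8` (`3 ≤ h`): both sides get explicit tables from the trace criterion, the design's extremal weight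
  monomial isolates `det A · det B` (`fullJoin_det_ne_zero_of_threshold`, p672458), and the one-cube door lands the witness.
* `partitionMinor_hit_of_core_copies` — COPY form: `u, w` (any injective families) each CONTAINING a copy of the core (`ι(J k) ∈ range u`
  for every core member) are hit. USE: with a ball / knapsack / any threshold core `T` on `m` states and `F ≤ h³ − m` free states this is the family
  «`T` plus at most `h³` further sets on each side, the two copies of `T` and the extra sets unrelated» — exponential range when
  `|T|` is exponential (e.g. `T = B_s([m])`), all `h`.

WHAT THIS IS NOT: the generic pair of down-sets in the middle range shares no threshold sub-family of co-size `≤ h³`; item 19717 OPEN;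
nothing on crux 14610 or VP ≠ VNP.
-/

set_option linter.dupNamespace false

namespace Summit.ValiantsHypothesis.ValiantsHypothesis.Theorems.BarrierLever.HiddenStates

open Finset Matrix
open Literature.Barriers.ValiantsHypothesis

noncomputable section

namespace FullJoin

variable {h r K : ℕ}

/-- **THE COMMON-CORE DOOR.** A strict threshold design «core + free singletons» with `K ≤ h³` states whose core is realised as traces by
BOTH families of the layout gives a partition minor hit inside `SmallCircuits ℂ (h + h) 8`. -/
theorem partitionMinor_hit_of_core_traces (hh : 3 ≤ h) (hK : K ≤ h * h * h)
    (u w : Fin r → Finset (Fin h)) (hu : Function.Injective u) (hw : Function.Injective w)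
    (J : Fin r → Finset (Fin K)) (hJ : Function.Injective J) (wt : Fin K → ℕ)
    (hthr : ∀ J' : Finset (Fin K), J' ∉ Set.range J → ∀ k : Fin r, ∑ q ∈ J k, wt q < ∑ q ∈ J', wt q)
    (core : Finset (Fin K)) (ι ι' : Fin K → Fin h) (hι : Set.InjOn ι core) (hι' : Set.InjOn ι' core)
    (hfree : ∀ k, ¬ J k ⊆ core → ∃ q, q ∉ core ∧ J k = {q})
    (hdown : ∀ k, J k ⊆ core → ∀ I ⊆ J k, ∃ k', J k' = I)
    (htrace_u : ∀ k, J k ⊆ core → ∃ i, u i ∩ core.image ι = (J k).image ι)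
    (htrace_w : ∀ k, J k ⊆ core → ∃ j, w j ∩ core.image ι' = (J k).image ι') :
    ∃ f ∈ SmallCircuits ℂ (h + h) 8,
      (Matrix.of fun i j : Fin r => MvPolynomial.coeff
        (∑ a ∈ u i, Finsupp.single (Fin.castAdd h a) 1 +
          ∑ c ∈ w j, Finsupp.single (Fin.natAdd h c) 1) f).det ≠ 0 := by
  classical
  obtain ⟨tx, hx⟩ := exists_table_of_core_trace u hu J hJ core ι hι hfree hdown htrace_u
  obtain ⟨ty, hy⟩ := exists_table_of_core_trace w hw J hJ core ι' hι' hfree hdown htrace_w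
  have hthr' : ∀ x : Fin 1 × Finset (Fin K), x ∉ Set.range (fun k : Fin r => ((0 : Fin 1), J k)) →
      ∀ i : Fin r, (fun _ : Fin 1 => (0 : ℕ)) ((fun k : Fin r => ((0 : Fin 1), J k)) i).1 +
          ∑ q ∈ ((fun k : Fin r => ((0 : Fin 1), J k)) i).2,
            (fun (_ : Fin 1) (q : Fin K) => wt q) ((fun k : Fin r => ((0 : Fin 1), J k)) i).1 q <
        (fun _ : Fin 1 => (0 : ℕ)) x.1 + ∑ q ∈ x.2, (fun (_ : Fin 1) (q : Fin K) => wt q) x.1 q := by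
    intro x hx' i
    have hx2 : x.2 ∉ Set.range J := by
      rintro ⟨k, hk⟩
      apply hx'
      refine ⟨k, ?_⟩
      ext
      · simp [Subsingleton.elim x.1 0]
      · simp [hk]
    simpa using hthr x.2 hx2 i
  have he : Function.Injective (fun k : Fin r => ((0 : Fin 1), J k)) := fun k k' hkk' => hJ (by simpa using hkk')
  obtain ⟨t₀, hdet⟩ := fullJoin_det_ne_zero_of_threshold h 1 K r u w (fun k => ((0 : Fin 1), J k)) he (fun _ => 0)
    (fun _ q => wt q) hthr' (fun _ => tx) (fun _ => ty) (by simpa using hx) (by simpa using hy)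
  refine partitionMinor_hit_of_fullJoin_mem h 1 K r hh (by omega) hK u w (fun _ => tx) (fun _ => ty) (fun p => t₀ ^ (0 : ℕ))
    (fun _ q => t₀ ^ wt q) ?_
  simpa using hdet

/-- A member `T ⊆ A` of the family realises the trace `T` on `A`. -/
theorem trace_of_mem (u : Fin r → Finset (Fin h))
    (A T : Finset (Fin h)) (hTA : T ⊆ A) (hT : T ∈ Set.range u) : ∃ i, u i ∩ A = T := by
  obtain ⟨i, hi⟩ := hT
  exact ⟨i, by rw [hi, Finset.inter_eq_left.mpr hTA]⟩

/-- **Copy form: two families containing copies of a common threshold core.** With the design as in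
`partitionMinor_hit_of_core_traces`, two injective families (lower or not) that each CONTAIN a copy of the core (`(J k).image ι ∈ range u`,
`(J k).image ι' ∈ range w` for every core member) are hit inside `SmallCircuits ℂ (h + h) 8`. -/
theorem partitionMinor_hit_of_core_copies (hh : 3 ≤ h) (hK : K ≤ h * h * h)
    (u w : Fin r → Finset (Fin h)) (hu : Function.Injective u) (hw : Function.Injective w)
    (J : Fin r → Finset (Fin K)) (hJ : Function.Injective J) (wt : Fin K → ℕ)
    (hthr : ∀ J' : Finset (Fin K), J' ∉ Set.range J → ∀ k : Fin r, ∑ q ∈ J k, wt q < ∑ q ∈ J', wt q)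
    (core : Finset (Fin K)) (ι ι' : Fin K → Fin h) (hι : Set.InjOn ι core) (hι' : Set.InjOn ι' core)
    (hfree : ∀ k, ¬ J k ⊆ core → ∃ q, q ∉ core ∧ J k = {q})
    (hdown : ∀ k, J k ⊆ core → ∀ I ⊆ J k, ∃ k', J k' = I)
    (hcopy_u : ∀ k, J k ⊆ core → (J k).image ι ∈ Set.range u)
    (hcopy_w : ∀ k, J k ⊆ core → (J k).image ι' ∈ Set.range w) :
    ∃ f ∈ SmallCircuits ℂ (h + h) 8,
      (Matrix.of fun i j : Fin r => MvPolynomial.coeff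
        (∑ a ∈ u i, Finsupp.single (Fin.castAdd h a) 1 +
          ∑ c ∈ w j, Finsupp.single (Fin.natAdd h c) 1) f).det ≠ 0 :=
  partitionMinor_hit_of_core_traces hh hK u w hu hw J hJ wt hthr core ι ι' hι hι' hfree hdown
    (fun k hk => trace_of_mem u _ _ (Finset.image_subset_image hk) (hcopy_u k hk))
    (fun k hk => trace_of_mem w _ _ (Finset.image_subset_image hk) (hcopy_w k hk))

end FullJoin

end

end Summit.ValiantsHypothesis.ValiantsHypothesis.Theorems.BarrierLever.HiddenStates
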